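import Mathlib
import HarnessLib
import Summits.ResolutionOfSingularities.ResolutionOfSingularities.Theorems.WildQuotientsWildQuotientResolutionS1aGoodOfKilledNode
import Summits.ResolutionOfSingularities.ResolutionOfSingularities.Theorems.WildQuotientsWildQuotientResolutionS1aTameRootChartAway
import Summits.ResolutionOfSingularities.ResolutionOfSingularities.Theorems.WildQuotientsWildQuotientResolutionS1aBlowupNodeAtlas

/-!
# S1a — GOODNESS HAS A BASIS: invariant basic opens `D(f)` with tame-root invariants

[OURS · L1 W4.5c · lead-1 g7; (T2e) consumer chain / bad-locus bookkeeping for `stub_winningStrategy`] — NOT statements of the manuscript;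
counted 0; AI-level work, weaker than expert review. Crux stmt-ResolutionOfSingularities-17941, line `s1a-logminvertex` v6.

For `G = ⟨g₀⟩` finite acting on `V` over `Y`, a `G`-stable affine open `O₁` on whose sections `g₀` acts (pull back along `g₀⁻¹`) with
TAME-ROOT fixed ring, and any `G`-stable open `U ∋ v` (`v ∈ O₁`):
* `idealOfPoint` — the prime `{a | a(v) = 0}` of `Γ(V, O)` (comap of the maximal ideal of the stalk);
* **`exists_invariant_basicOpen`** — there is a `G`-INVARIANT section `f` with `v ∈ D(f) ⊆ U` (prime avoidance over the orbit of `v`,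
  then the norm `∏_g g·b`);
* **`nonempty_eqLocus_basicOpen_equiv`** — the `g₀`-fixed sections over `D(f)` are the localisation of the `g₀`-fixed sections over `O₁` at
  `f` ((N1) `exists_fixed_mk'_of_apply_eq`), hence (`isTameRootChart_eqLocus_basicOpen`) again a tame root chart (`IsTameRootChart.away`);
* `nonempty_invariantsRing_equiv_eqLocus` — the ring of invariants of the quotient-gluing API vs the fixed ring of `g₀` (the bridge inside
  `isGoodAt_of_nodeChart_invariants`, exported);
* **`GameFrame.GModel.exists_good_le`** — a GOOD point has arbitrarily small good `G`-stable affine neighbourhoods inside any `G`-stable open,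
  of the form `D(f)` in a good chart, with tame-root `g₀`-fixed sections.
-/

set_option linter.dupNamespace false

noncomputable section

open CategoryTheory AlgebraicGeometry TopologicalSpace
open Literature.AlgebraicGeometry.Resolution Literature.AlgebraicGeometry.RelativeSpec
open Summit.ResolutionOfSingularities.ResolutionOfSingularities.Theorems.WildQuotientResolution.S1
open Summit.ResolutionOfSingularities.ResolutionOfSingularities.Theorems.WildQuotientResolution.S1.NodeAtlas
open Summit.ResolutionOfSingularities.ResolutionOfSingularities.Theorems.WildQuotientResolution.S1.InvariantsRegular
open Summit.ResolutionOfSingularities.ResolutionOfSingularities.Theorems.WildQuotientResolution.S1.BlowupCharts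

namespace Summit.ResolutionOfSingularities.ResolutionOfSingularities.Theorems.WildQuotientResolution.S1.GoodCharts

universe u

section Point

variable {V : Scheme.{u}}

/-- The prime ideal of sections over `O` vanishing at `v ∈ O`. [OURS · L1 W4.5c] -/
def idealOfPoint (O : V.Opens) (v : V) (hv : v ∈ O) : Ideal Γ(V, O) :=
  (IsLocalRing.maximalIdeal (V.presheaf.stalk v)).comap (V.presheaf.germ O v hv).hom

/-- `a ∉ 𝔭_v ↔ v ∈ D(a)`. -/
theorem not_mem_idealOfPoint_iff (O : V.Opens) (v : V) (hv : v ∈ O) (a : Γ(V, O)) :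
    a ∉ idealOfPoint O v hv ↔ v ∈ V.basicOpen a := by
  rw [idealOfPoint, Ideal.mem_comap, IsLocalRing.mem_maximalIdeal, mem_nonunits_iff, not_not, V.mem_basicOpen a v hv]

/-- `𝔭_v` is prime. -/
theorem isPrime_idealOfPoint (O : V.Opens) (v : V) (hv : v ∈ O) : (idealOfPoint O v hv).IsPrime :=
  Ideal.IsPrime.comap _

/-- `D(Σ cᵢ aᵢ) ⊆ ⋃ D(aᵢ)`: if a combination of the `aᵢ` is invertible at `y` then some `aᵢ` is. -/
theorem exists_mem_basicOpen_of_mem_span {O : V.Opens} {ι : Type*} (a : ι → Γ(V, O)) {x : Γ(V, O)}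
    (hx : x ∈ Ideal.span (Set.range a)) {y : V} (hy : y ∈ V.basicOpen x) : ∃ i, y ∈ V.basicOpen (a i) := by
  have hyO : y ∈ O := V.basicOpen_le x hy
  by_contra hcon
  push Not at hcon
  have hx' : x ∈ idealOfPoint O y hyO := by
    refine (Ideal.span_le.mpr ?_) hx
    rintro _ ⟨i, rfl⟩
    by_contra h
    exact hcon i ((not_mem_idealOfPoint_iff O y hyO (a i)).mp h)
  exact (not_mem_idealOfPoint_iff O y hyO x).mpr hy hx'

end Point

section Shrink

variable {V Y : Scheme.{u}} {r : V ⟶ Y} {G : Type u} [Group G] (ρ : ActionOver r G) (O₁ : ρ.StableAffineOpens)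

/-- The action of `g` on `Γ(V, O₁)` (pull back along `g⁻¹`), bundled as a ring hom. -/
abbrev actO (g : G) : Γ(V, O₁.1) →+* Γ(V, O₁.1) := ((ρ.aut g⁻¹).hom.appLE O₁.1 O₁.1 (O₁.2.1 g⁻¹).ge).hom

/-- `v ∈ D(g·a) ↔ g⁻¹ v ∈ D(a)` (for `v ∈ O₁`). -/
theorem mem_basicOpen_actO_iff (g : G) (a : Γ(V, O₁.1)) (v : V) (hv : v ∈ O₁.1) :
    v ∈ V.basicOpen (actO ρ O₁ g a) ↔ (ρ.aut g⁻¹).hom.base v ∈ V.basicOpen a := by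
  rw [actO, Scheme.basicOpen_appLE]
  exact ⟨fun h => h.2, fun h => ⟨hv, h⟩⟩

/-- `g⁻¹* D(a) = D(g·a)` (preimage form). -/
theorem preimage_basicOpen_eq (g : G) (a : Γ(V, O₁.1)) :
    (ρ.aut g⁻¹).hom ⁻¹ᵁ V.basicOpen a = V.basicOpen (actO ρ O₁ g a) := by
  rw [actO, Scheme.basicOpen_appLE]
  refine le_antisymm (fun x hx => ⟨?_, hx⟩) inf_le_right
  have : x ∈ (ρ.aut g⁻¹).hom ⁻¹ᵁ O₁.1 := V.basicOpen_le a hx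
  rwa [O₁.2.1 g⁻¹] at this

/-- An invariant basic open is `G`-stable. -/
theorem preimage_basicOpen_of_invariant {f : Γ(V, O₁.1)} (hf : ∀ g : G, actO ρ O₁ g f = f) (g : G) :
    (ρ.aut g).hom ⁻¹ᵁ V.basicOpen f = V.basicOpen f := by
  have := preimage_basicOpen_eq ρ O₁ g⁻¹ f
  rwa [inv_inv, hf] at this

/-- The laws of the action on `Γ(V, O₁)`: composition. -/
theorem actO_actO (g h : G) (b : Γ(V, O₁.1)) : actO ρ O₁ g (actO ρ O₁ h b) = actO ρ O₁ (g * h) b := by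
  change (ρ.aut g⁻¹).hom.appLE O₁.1 O₁.1 (O₁.2.1 g⁻¹).ge ((ρ.aut h⁻¹).hom.appLE O₁.1 O₁.1 (O₁.2.1 h⁻¹).ge b) = _
  rw [← appLE_aut_mul ρ O₁.1 O₁.2.1 h⁻¹ g⁻¹ b, ← mul_inv_rev]

/-- The laws of the action on `Γ(V, O₁)`: unit. -/
theorem actO_one (b : Γ(V, O₁.1)) : actO ρ O₁ 1 b = b := by
  change (ρ.aut 1⁻¹).hom.appLE O₁.1 O₁.1 (O₁.2.1 1⁻¹).ge b = b
  have := appLE_aut_one ρ O₁.1 O₁.2.1 b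
  convert this using 2
  simp

/-- **An invariant basic open through `v` inside any `G`-stable open** (`G` finite, `O₁` affine). [OURS · L1 W4.5c] -/
theorem exists_invariant_basicOpen [Finite G] (hO₁ : IsAffineOpen O₁.1) {v : V} (hv : v ∈ O₁.1) (U : V.Opens)
    (hU : ∀ g : G, (ρ.aut g).hom ⁻¹ᵁ U = U) (hvU : v ∈ U) :
    ∃ f : Γ(V, O₁.1), (∀ g : G, actO ρ O₁ g f = f) ∧ v ∈ V.basicOpen f ∧ V.basicOpen f ≤ U := by
  classical
  letI := Fintype.ofFinite G
  -- the orbit of `v`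
  have horbO : ∀ g : G, (ρ.aut g).hom.base v ∈ O₁.1 := fun g => by
    have : v ∈ (ρ.aut g).hom ⁻¹ᵁ O₁.1 := by rw [O₁.2.1 g]; exact hv
    exact this
  have horbU : ∀ g : G, (ρ.aut g).hom.base v ∈ U := fun g => by
    have : v ∈ (ρ.aut g).hom ⁻¹ᵁ U := by rw [hU g]; exact hvU
    exact this
  -- basic opens through the orbit points, inside `U`
  have ha : ∀ g : G, ∃ a : Γ(V, O₁.1), V.basicOpen a ≤ U ∧ (ρ.aut g).hom.base v ∈ V.basicOpen a := fun g =>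
    IsAffineOpen.exists_basicOpen_le hO₁ ⟨(ρ.aut g).hom.base v, horbU g⟩ (horbO g)
  choose a haU hav using ha
  -- prime avoidance over the orbit
  have havoid : ∃ b ∈ Ideal.span (Set.range a), ∀ g : G, b ∉ idealOfPoint O₁.1 ((ρ.aut g).hom.base v) (horbO g) := by
    by_contra hcon
    push Not at hcon
    have hsub : ((Ideal.span (Set.range a) : Ideal Γ(V, O₁.1)) : Set Γ(V, O₁.1)) ⊆
        ⋃ g ∈ (↑(Finset.univ : Finset G) : Set G), (idealOfPoint O₁.1 ((ρ.aut g).hom.base v) (horbO g) : Set Γ(V, O₁.1)) := by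
      intro b hb
      obtain ⟨g, hg⟩ := hcon b hb
      exact Set.mem_iUnion₂.mpr ⟨g, Finset.mem_univ g, hg⟩
    obtain ⟨g, -, hle⟩ := (Ideal.subset_union_prime (1 : G) (1 : G) fun g _ _ _ =>
      isPrime_idealOfPoint O₁.1 ((ρ.aut g).hom.base v) (horbO g)).mp hsub
    exact (not_mem_idealOfPoint_iff O₁.1 _ (horbO g) (a g)).mpr (hav g) (hle (Ideal.subset_span ⟨g, rfl⟩))
  obtain ⟨b, hbJ, hbv⟩ := havoid
  -- the norm `f = ∏ g·b`
  refine ⟨∏ g : G, actO ρ O₁ g b, fun g => ?_, ?_, ?_⟩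
  · -- invariant
    rw [map_prod]
    simp_rw [actO_actO]
    exact Fintype.prod_equiv (Equiv.mulLeft g) _ _ fun h => rfl
  · -- `v ∈ D(f)`: every `g·b` is invertible at `v`
    rw [V.mem_basicOpen _ v hv, map_prod]
    refine Finset.prod_induction _ IsUnit (fun _ _ => IsUnit.mul) isUnit_one fun g _ => ?_
    rw [← V.mem_basicOpen _ v hv, mem_basicOpen_actO_iff ρ O₁ g b v hv,
      ← not_mem_idealOfPoint_iff O₁.1 _ (horbO g⁻¹)]
    exact hbv g⁻¹
  · -- `D(f) ⊆ D(b) ⊆ ⋃ D(a_g) ⊆ U`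
    intro y hy
    have hyO : y ∈ O₁.1 := V.basicOpen_le _ hy
    have hyb : y ∈ V.basicOpen b := by
      rw [V.mem_basicOpen _ y hyO] at hy ⊢
      rw [map_prod] at hy
      have h1 := isUnit_of_dvd_unit (Finset.dvd_prod_of_mem _ (Finset.mem_univ (1 : G))) hy
      rwa [actO_one] at h1
    obtain ⟨g, hg⟩ := exists_mem_basicOpen_of_mem_span a hbJ hyb
    exact haU g hg

variable {g₀ : G}

/-- **The `g₀`-fixed sections over an invariant basic open `D(f)` are the localisation at `f` of the `g₀`-fixed sections over `O₁`.**
[OURS · L1 W4.5c] -/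
theorem nonempty_eqLocus_basicOpen_equiv (hO₁ : IsAffineOpen O₁.1) {f : Γ(V, O₁.1)} (hf : ∀ g : G, actO ρ O₁ g f = f) :
    Nonempty (↥(RingHom.eqLocus
        ((ρ.aut g₀⁻¹).hom.appLE (V.basicOpen f) (V.basicOpen f) (preimage_basicOpen_of_invariant ρ O₁ hf g₀⁻¹).ge).hom
        (RingHom.id _)) ≃+*
      Localization.Away (⟨f, hf g₀⟩ : RingHom.eqLocus (actO ρ O₁ g₀) (RingHom.id _))) := by
  -- notation
  let A' : Subring Γ(V, O₁.1) := RingHom.eqLocus (actO ρ O₁ g₀) (RingHom.id _)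
  let fbar : A' := ⟨f, hf g₀⟩
  let τ' : Γ(V, V.basicOpen f) →+* Γ(V, V.basicOpen f) := ((ρ.aut g₀⁻¹).hom.appLE (V.basicOpen f) (V.basicOpen f)
    (preimage_basicOpen_of_invariant ρ O₁ hf g₀⁻¹).ge).hom
  -- `τ = actO g₀` as a ring automorphism of `Γ(V, O₁)`
  let τ : Γ(V, O₁.1) ≃+* Γ(V, O₁.1) := RingEquiv.ofRingHom (actO ρ O₁ g₀) (actO ρ O₁ g₀⁻¹)
    (RingHom.ext fun x => by rw [RingHom.comp_apply, actO_actO, mul_inv_cancel, actO_one]; rfl)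
    (RingHom.ext fun x => by rw [RingHom.comp_apply, actO_actO, inv_mul_cancel, actO_one]; rfl)
  have hτ : ∀ x, τ x = actO ρ O₁ g₀ x := fun _ => rfl
  -- `Γ(V, D(f)) = Γ(V, O₁)[f⁻¹]` and `τ'` extends `τ`
  haveI : IsLocalization.Away f Γ(V, V.basicOpen f) := hO₁.isLocalization_basicOpen f
  have hφ : ∀ c : Γ(V, O₁.1), τ' (algebraMap _ Γ(V, V.basicOpen f) c) = algebraMap _ Γ(V, V.basicOpen f) (τ c) := fun c => by
    change ((V.presheaf.map (homOfLE (V.basicOpen_le f)).op) ≫ (ρ.aut g₀⁻¹).hom.appLE _ _ _) c =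
      ((ρ.aut g₀⁻¹).hom.appLE O₁.1 O₁.1 _ ≫ V.presheaf.map (homOfLE (V.basicOpen_le f)).op) c
    rw [Scheme.Hom.map_appLE, Scheme.Hom.appLE_map]
  -- the denominators `fⁿ`
  have hT : (Submonoid.powers fbar).map A'.subtype = Submonoid.powers f := by
    rw [Submonoid.map_powers]; rfl
  haveI : IsLocalization ((Submonoid.powers fbar).map A'.subtype) Γ(V, V.basicOpen f) := by
    rw [hT]; infer_instance
  have hTfix : ∀ t ∈ (Submonoid.powers fbar).map A'.subtype, τ t = t := by
    rintro _ ⟨y, -, rfl⟩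
    exact y.2
  -- the map `A'[f̄⁻¹] → Γ(V, D(f))`
  let ψ : Localization.Away fbar →+* Γ(V, V.basicOpen f) :=
    IsLocalization.map Γ(V, V.basicOpen f) A'.subtype (Submonoid.powers fbar).le_comap_map
  have hψinj : Function.Injective ψ := IsLocalization.map_injective_of_injective _ _ _ Subtype.val_injective
  -- fixed fractions
  have hfixmk : ∀ (c : Γ(V, O₁.1)) (s : ↥((Submonoid.powers fbar).map A'.subtype)), τ c = c →
      τ' (IsLocalization.mk' Γ(V, V.basicOpen f) c s) = IsLocalization.mk' Γ(V, V.basicOpen f) c s := by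
    intro c s hc
    have hU : IsUnit (algebraMap Γ(V, O₁.1) Γ(V, V.basicOpen f) (s : Γ(V, O₁.1))) := IsLocalization.map_units _ s
    have hspec := IsLocalization.mk'_spec Γ(V, V.basicOpen f) c s
    have key : τ' (IsLocalization.mk' Γ(V, V.basicOpen f) c s) * algebraMap _ Γ(V, V.basicOpen f) (s : Γ(V, O₁.1)) =
        algebraMap _ Γ(V, V.basicOpen f) c := by
      have := congrArg τ' hspec
      rw [map_mul, hφ, hφ, hTfix _ s.2, hc] at this
      exact this
    exact hU.mul_left_injective (key.trans hspec.symm)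
  -- the image is the `τ'`-fixed subring
  have hmem : ∀ x, ψ x ∈ RingHom.eqLocus τ' (RingHom.id _) := by
    intro x
    obtain ⟨c, s, rfl⟩ := IsLocalization.exists_mk'_eq (Submonoid.powers fbar) x
    rw [IsLocalization.map_mk']
    exact hfixmk _ _ c.2
  have hsurj : ∀ y ∈ RingHom.eqLocus τ' (RingHom.id _), ∃ x, ψ x = y := by
    intro y hy
    obtain ⟨c, t, hc, rfl⟩ := exists_fixed_mk'_of_apply_eq τ ((Submonoid.powers fbar).map A'.subtype) hTfix τ' hφ hy
    obtain ⟨_, ⟨s, hs, rfl⟩⟩ := t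
    exact ⟨IsLocalization.mk' _ (⟨c, hc⟩ : A') ⟨s, hs⟩, IsLocalization.map_mk' _ _ _⟩
  exact ⟨(RingEquiv.ofBijective (ψ.codRestrict _ hmem)
    ⟨fun x y hxy => hψinj (congrArg Subtype.val hxy), fun y => by
      obtain ⟨x, hx⟩ := hsurj y.1 y.2
      exact ⟨x, Subtype.ext hx⟩⟩).symm⟩

/-- **Tame-root fixed sections localise to invariant basic opens.** [OURS · L1 W4.5c] -/
theorem isTameRootChart_eqLocus_basicOpen (hO₁ : IsAffineOpen O₁.1) {f : Γ(V, O₁.1)} (hf : ∀ g : G, actO ρ O₁ g f = f)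
    (htame : IsTameRootChart ↥(RingHom.eqLocus (actO ρ O₁ g₀) (RingHom.id _))) :
    IsTameRootChart ↥(RingHom.eqLocus
        ((ρ.aut g₀⁻¹).hom.appLE (V.basicOpen f) (V.basicOpen f) (preimage_basicOpen_of_invariant ρ O₁ hf g₀⁻¹).ge).hom
        (RingHom.id _)) := by
  obtain ⟨e⟩ := nonempty_eqLocus_basicOpen_equiv ρ O₁ (g₀ := g₀) hO₁ hf
  exact IsTameRootChart.of_ringEquiv e (htame.away _)

/-- **The bridge, exported**: for `G = ⟨g₀⟩`, the ring of invariants `Γ(O, ⊤)^G` of the quotient-gluing API is isomorphic to the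
`g₀`-fixed subring of `Γ(V, O)`. [OURS · L1 W4.5c] -/
theorem nonempty_invariantsRing_equiv_eqLocus (hG : ∀ g : G, g ∈ Subgroup.zpowers g₀) :
    Nonempty (↥((ρ.restrict O₁.1 O₁.2.1).invariantsRing ⊤) ≃+* ↥(RingHom.eqLocus (actO ρ O₁ g₀) (RingHom.id _))) := by
  let ψ : Γ(V, O₁.1) ≃+* Γ(↑O₁.1, (O₁.1.ι ≫ r) ⁻¹ᵁ ⊤) :=
    (asIso (O₁.1.ι.appLE O₁.1 ⊤ O₁.1.ι_preimage_self.ge)).commRingCatIsoToRingEquiv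
  have hψ : ∀ t, ψ t = O₁.1.ι.appLE O₁.1 ⊤ O₁.1.ι_preimage_self.ge t := fun _ => rfl
  have hact : ∀ t : Γ(V, O₁.1), (ρ.restrict O₁.1 O₁.2.1).act g₀ ⊤ (ψ t) = ψ (actO ρ O₁ g₀ t) := fun t => by
    rw [hψ, hψ]
    exact ρ.act_restrict_top_appLE O₁ g₀ t O₁.1.ι_preimage_self.ge (O₁.2.1 g₀⁻¹).ge
  refine ⟨ψ.symm.restrict ((ρ.restrict O₁.1 O₁.2.1).invariantsRing ⊤) (RingHom.eqLocus (actO ρ O₁ g₀) (RingHom.id _))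
    fun x => ?_⟩
  obtain ⟨t, rfl⟩ : ∃ t, ψ t = x := ⟨ψ.symm x, ψ.apply_symm_apply x⟩
  rw [ActionOver.mem_invariantsRing_iff]
  simp only [RingEquiv.symm_apply_apply, RingHom.mem_eqLocus, RingHom.id_apply]
  constructor
  · intro hx
    have h1 := hx g₀
    rw [hact] at h1
    exact ψ.injective h1
  · intro hx
    have h2 : (ρ.restrict O₁.1 O₁.2.1).act g₀ ⊤ (ψ t) = ψ t := by rw [hact, hx]
    exact fun g => ActionOver.act_eq_self_of_generator (ρ.restrict O₁.1 O₁.2.1) hG ⊤ h2 g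

end Shrink

end GoodCharts

/-! ## The game-level statement -/

namespace GameFrame.GModel

open GoodCharts

variable {p : ℕ} {X' X₁ : Scheme.{0}} {q : X' ⟶ X₁} {G : Type} [Group G] {ρ : G →* Aut X'} {g₀ : G}

/-- **A GOOD point has arbitrarily small GOOD `G`-stable affine neighbourhoods.** For `G = ⟨g₀⟩` finite, if `M` is good at `v` and
`U ∋ v` is any `G`-stable open, there is a `G`-stable affine open `O₂ ∋ v` inside `U`, affine over the base, whose `g₀`-fixed sections
form a tame root chart (so `O₂` again witnesses goodness). [OURS · L1 W4.5c] -/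
theorem exists_good_le [Finite G] (M : GModel p q G ρ g₀) (hG : ∀ g : G, g ∈ Subgroup.zpowers g₀) {v : M.V}
    (hgood : M.IsGoodAt v) (U : M.V.Opens) (hU : ∀ g : G, (M.act.aut g).hom ⁻¹ᵁ U = U) (hvU : v ∈ U) :
    ∃ O₂ : M.act.StableAffineOpens, v ∈ O₂.1 ∧ O₂.1 ≤ U ∧ IsAffineOpen O₂.1 ∧
      IsTameRootChart ↥(RingHom.eqLocus (actO M.act O₂ g₀) (RingHom.id _)) := by
  obtain ⟨O₁, hv, hO₁, htame⟩ := hgood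
  obtain ⟨e₁⟩ := nonempty_invariantsRing_equiv_eqLocus M.act O₁ hG
  have htame₁ : IsTameRootChart ↥(RingHom.eqLocus (actO M.act O₁ g₀) (RingHom.id _)) := IsTameRootChart.of_ringEquiv e₁.symm htame
  obtain ⟨f, hf, hvf, hfU⟩ := exists_invariant_basicOpen M.act O₁ hO₁ hv U hU hvU
  have hstab := preimage_basicOpen_of_invariant M.act O₁ hf
  -- `D(f)` is affine over the base: `D(f) → O₁ → X₁`
  haveI : IsAffineHom ((M.V.basicOpen f).ι ≫ M.r) := by
    haveI : IsAffine (M.V.basicOpen f : M.V.Opens) := hO₁.basicOpen f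
    haveI : IsAffine (O₁.1 : M.V.Opens) := hO₁
    haveI := O₁.2.2
    have : (M.V.basicOpen f).ι ≫ M.r = M.V.homOfLE (M.V.basicOpen_le f) ≫ (O₁.1.ι ≫ M.r) := by
      rw [← Category.assoc, Scheme.homOfLE_ι]
    rw [this]
    infer_instance
  refine ⟨⟨M.V.basicOpen f, hstab, inferInstance⟩, hvf, hfU, hO₁.basicOpen f, ?_⟩
  exact isTameRootChart_eqLocus_basicOpen M.act O₁ hO₁ hf htame₁

/-- … and in particular `O₂` witnesses goodness at every point of it. -/
theorem isGoodAt_of_tame_eqLocus (M : GModel p q G ρ g₀) (hG : ∀ g : G, g ∈ Subgroup.zpowers g₀)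
    (O₂ : M.act.StableAffineOpens) (hO₂ : IsAffineOpen O₂.1)
    (htame : IsTameRootChart ↥(RingHom.eqLocus (actO M.act O₂ g₀) (RingHom.id _))) {w : M.V} (hw : w ∈ O₂.1) :
    M.IsGoodAt w :=
  M.isGoodAt_of_nodeChart_invariants hG w O₂ hw hO₂ (RingEquiv.refl _) (actO M.act O₂ g₀) (fun _ => rfl) htame

end GameFrame.GModel

end Summit.ResolutionOfSingularities.ResolutionOfSingularities.Theorems.WildQuotientResolution.S1

end
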